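import Summits.AtomisticToContinuum.Crystallization.Theorems.ChartedZeroExcessLayeredLatticeLiouvilleZZZYRCXL
import Summits.AtomisticToContinuum.Crystallization.Theorems.ChartedZeroExcessLayeredLatticeLiouvilleZZZYRCXRK

/-!
# ChartedZeroExcessLayeredLatticeLiouville · ZZZYRCXRL — LEMMAS OF THE θ⁰ OUT-OF-WINDOW KERNEL, §1–§4 (letters as a function; the walk invariant)
(decomp-a2c hand-1 g55, STAGED with RCXRK for g56; critic r1871 (D) «A1 = the θ_out kernel delta of record»; memo RCXR-DESIGN-g55 ADDENDUM A)

§1 `vecL ρ` (piece vector under a letter assignment `ρ : shifted layer → letter`; `vecZ w p = vecL (regN w p)` by `rfl`), `AdmO win wlo whi ρ`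
(agrees with the window letters, `≤ 2` everywhere), the kernel's trial letters `trialA/trialB` selected by `ρ` and ★ `regO_trial_start/end`:
with far trial `ρ amY` and those trials the lookup returns EXACTLY `ρ` at both endpoint layers (priority window > far > start > end is consistent);
§2 `maxAll_some` (success ⇒ every trial `some v ≤ max`), `cR_le_cRmax`; §3 ★ `pieceEvalO_sound` (one trial: code range, `0 < n9 ≤ P9max` for the
looked-up letters, value = `coefNn` at `|form|` — RCXK's offset identities); §4 ★ `pieceO_sound` (all trials ⇒ the facts for EVERY admissible `ρ`
whose context `ctxOf ρ amY f0 f1 g …` is listed, and `coefNn(ρ) ≤ max`) and ★★ `walkPO_sound` (the out walk invariant: pieces valid under `ρ`,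
R sums grow by `cRmax` per piece exactly, N sums grow by AT LEAST `ρ`'s coefficient per piece).  §5–§6 (one out-chord, the slab fold,
★★ `slabAccO_sound`) are the sequel «ZZZYRCXRS»; §7 (countWinsO semantics + Δm-block pigeonhole) and the assembly to lens-2's 5c contract are
g56's.  Imports RCXL + RCXRK; 0 sorry.  All `[folklore]`.
-/

namespace Summit.AtomisticToContinuum.Crystallization.Theorems.ChartedZeroExcessLayeredLatticeLiouville.ThetaKernel

/-! ## §1 letters as a function on shifted layers -/

/-- the signed refined vector of a piece under a LETTER ASSIGNMENT `ρ` (shifted layer ↦ letter): `(3Δγ₀ + Δρ, 3Δγ₁ + Δρ, Δm)`.  The periodic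
kernel's `vecZ w p` is the case `ρ = regN w p` (`vecZ_eq_vecL`, `rfl`). -/
def vecL (ρ : ℕ → ℕ) (pr : (ℕ × ℕ × ℕ) × (ℕ × ℕ × ℕ)) : ℤ × ℤ × ℤ :=
  (3 * ((pr.2.1 : ℤ) - pr.1.1) + ((ρ pr.2.2.2 : ℤ) - ρ pr.1.2.2),
    3 * ((pr.2.2.1 : ℤ) - pr.1.2.1) + ((ρ pr.2.2.2 : ℤ) - ρ pr.1.2.2), (pr.2.2.2 : ℤ) - pr.1.2.2)

/-- the periodic kernel's piece vector is `vecL (regN w p)`. [folklore] -/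
theorem vecZ_eq_vecL (w : List ℕ) (p : ℕ) (pr : (ℕ × ℕ × ℕ) × (ℕ × ℕ × ℕ)) : vecZ w p pr = vecL (regN w p) pr := rfl

/-- an ADMISSIBLE letter assignment for the window `[wlo, whi]` with letters `win`: it agrees with `win` on the window and is `≤ 2` everywhere
(the out-of-window letters are arbitrary in `{0,1,2}` — the aperiodic registries). -/
def AdmO (win : List ℕ) (wlo whi : ℕ) (ρ : ℕ → ℕ) : Prop :=
  (∀ am, inWin wlo whi am = true → ρ am = win.getD (am - wlo) 0) ∧ ∀ am, ρ am ≤ 2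

/-- the kernel's trial letter for the START layer of a piece under `ρ`: `ρ am` if that layer is free, else the dummy `0`. -/
def trialA (wlo whi amY am : ℕ) (ρ : ℕ → ℕ) : ℕ := bif (!(inWin wlo whi am) && !(Nat.beq am amY)) then ρ am else 0

/-- the kernel's trial letter for the END layer of a piece under `ρ`. -/
def trialB (wlo whi amY am bm : ℕ) (ρ : ℕ → ℕ) : ℕ := bif (!(inWin wlo whi bm) && !(Nat.beq bm amY) && !(Nat.beq bm am)) then ρ bm else 0

/-- the trial letter of a free layer is one of `{0,1,2}`; of a bound layer it is the dummy `0` — either way it is in `trials`. [folklore] -/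
theorem trialA_mem (wlo whi amY am : ℕ) {ρ : ℕ → ℕ} (h2 : ∀ x, ρ x ≤ 2) :
    trialA wlo whi amY am ρ ∈ trials (!(inWin wlo whi am) && !(Nat.beq am amY)) := by
  unfold trialA trials
  cases (!(inWin wlo whi am) && !(Nat.beq am amY))
  · simp
  · have := h2 am
    simp only [cond_true, List.mem_cons, List.not_mem_nil, or_false]
    omega

/-- the same for the end layer. [folklore] -/
theorem trialB_mem (wlo whi amY am bm : ℕ) {ρ : ℕ → ℕ} (h2 : ∀ x, ρ x ≤ 2) :
    trialB wlo whi amY am bm ρ ∈ trials (!(inWin wlo whi bm) && !(Nat.beq bm amY) && !(Nat.beq bm am)) := by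
  unfold trialB trials
  cases (!(inWin wlo whi bm) && !(Nat.beq bm amY) && !(Nat.beq bm am))
  · simp
  · have := h2 bm
    simp only [cond_true, List.mem_cons, List.not_mem_nil, or_false]
    omega

/-- ★ under an admissible `ρ` with far trial `rY = ρ amY`, the kernel's lookup at the START layer with the trials of `ρ` returns `ρ am`. [folklore] -/
theorem regO_trial_start {win : List ℕ} {wlo whi : ℕ} {ρ : ℕ → ℕ} (hρ : AdmO win wlo whi ρ) (amY am bm : ℕ) :
    regO win wlo whi amY (ρ amY) am (trialA wlo whi amY am ρ) (trialB wlo whi amY am bm ρ) am = ρ am := by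
  unfold regO trialA
  cases hw : inWin wlo whi am
  · simp only [cond_false, Bool.not_false, Bool.true_and]
    cases hy : Nat.beq am amY
    · simp only [cond_false, Bool.not_false, cond_true, Nat.beq_refl]
    · simp only [cond_true]
      rw [Nat.eq_of_beq_eq_true hy]
  · simp only [cond_true]
    exact (hρ.1 am hw).symm

/-- ★ … and at the END layer it returns `ρ bm`. [folklore] -/
theorem regO_trial_end {win : List ℕ} {wlo whi : ℕ} {ρ : ℕ → ℕ} (hρ : AdmO win wlo whi ρ) (amY am bm : ℕ) :
    regO win wlo whi amY (ρ amY) am (trialA wlo whi amY am ρ) (trialB wlo whi amY am bm ρ) bm = ρ bm := by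
  unfold regO trialA trialB
  cases hw : inWin wlo whi bm
  · simp only [cond_false, Bool.not_false, Bool.true_and]
    cases hy : Nat.beq bm amY
    · simp only [cond_false, Bool.not_false, Bool.true_and]
      cases hba : Nat.beq bm am
      · simp only [cond_false, Bool.not_false, cond_true]
      · simp only [cond_true]
        have hbm : bm = am := Nat.eq_of_beq_eq_true hba
        subst hbm
        cases hwa : inWin wlo whi bm
        · simp only [Bool.not_false, Bool.true_and]
          rw [hy]
          simp
        · rw [hwa] at hw; exact absurd hw (by simp)
    · simp only [cond_true]
      rw [Nat.eq_of_beq_eq_true hy]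
  · simp only [cond_true]
    exact (hρ.1 bm hw).symm

/-! ## §2 the trial fold -/

/-- ★ `maxAll l = some m` ⇒ every entry is `some v` with `v ≤ m`. [folklore] -/
theorem maxAll_some : ∀ (l : List (Option ℕ)) (m : ℕ), maxAll l = some m → ∀ x ∈ l, ∃ v, x = some v ∧ v ≤ m
  | [], _, _, x, hx => absurd hx (by simp)
  | none :: rest, m, h, x, hx => by simp [maxAll] at h
  | some v :: rest, m, h, x, hx => by
    simp only [maxAll] at h
    cases hr : maxAll rest with
    | none => rw [hr] at h; exact absurd h (by simp)
    | some m' =>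
      rw [hr] at h
      simp only [Option.some.injEq] at h
      rcases List.mem_cons.mp hx with rfl | hx
      · exact ⟨v, rfl, by rw [← h]; exact Nat.le_max_left _ _⟩
      · obtain ⟨v', hv', hle⟩ := maxAll_some rest m' hr x hx
        exact ⟨v', hv', by rw [← h]; exact hle.trans (Nat.le_max_right _ _)⟩

/-- every context's `cR` is at most `cRmax`. [folklore] -/
theorem cR_le_cRmax {ctxs : List OCtx} {κ : OCtx} (hκ : κ ∈ ctxs) : κ.cR ≤ cRmax ctxs := by
  unfold cRmax
  have key : ∀ (l : List ℕ) (init : ℕ), init ≤ l.foldl Nat.max init ∧ ∀ x ∈ l, x ≤ l.foldl Nat.max init := by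
    intro l
    induction l with
    | nil => intro init; simp
    | cons y rest ih =>
      intro init
      rw [List.foldl_cons]
      obtain ⟨h1, h2⟩ := ih (Nat.max init y)
      refine ⟨(Nat.le_max_left _ _).trans h1, fun x hx => ?_⟩
      rcases List.mem_cons.mp hx with rfl | hx
      · exact (Nat.le_max_right _ _).trans h1
      · exact h2 x hx
  exact (key _ 0).2 _ (List.mem_map.mpr ⟨κ, hκ, rfl⟩)

/-! ## §3 one trial of one piece -/

/-- ★ ONE TRIAL IS SOUND: if `pieceEvalO … = some v` (start site in range, start letter `≤ 2`), then the code is in range, the piece vector with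
the LOOKED-UP letters has `0 < n9 ≤ P9max`, and `v` is the dyadic N coefficient at `|form|` for a context whose form fields are the sign
splits of `(f0, f1, g)` with the offset constant `C = 3603(f0 + f1) + 1201 g`. [folklore] -/
theorem pieceEvalO_sound (win : List ℕ) (wlo whi amY P9 An rY Bn U4n cR : ℕ) (f0 f1 g : ℤ)
    {a0 a1 am b0 b1 bm c ra rb v : ℕ} (ha0 : a0 < 1201) (ha1 : a1 < 1201) (ham : am < 1201)
    (hrA : regO win wlo whi amY rY am ra rb am ≤ 2)
    (h : pieceEvalO win wlo whi amY P9 An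
      ⟨rY, f0.toNat, (-f0).toNat, f1.toNat, (-f1).toNat, g.toNat, (-g).toNat,
        (3603 * (f0 + f1) + 1201 * g).toNat, (-(3603 * (f0 + f1) + 1201 * g)).toNat, Bn, U4n, cR⟩ a0 a1 am b0 b1 bm c ra rb = some v) :
    let vv : ℤ × ℤ × ℤ := (3 * ((b0 : ℤ) - a0) + ((regO win wlo whi amY rY am ra rb bm : ℤ) - regO win wlo whi amY rY am ra rb am),
      3 * ((b1 : ℤ) - a1) + ((regO win wlo whi amY rY am ra rb bm : ℤ) - regO win wlo whi amY rY am ra rb am), (bm : ℤ) - am)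
    c < 1732323601 ∧ 0 < n9Z vv ∧ n9Z vv ≤ P9 ∧ v = coefNn An Bn U4n (n9Z vv).toNat (formZ f0 f1 g vv).natAbs := by
  intro vv
  unfold pieceEvalO at h
  extract_lets rA rB x0 x1 xm p9n P Q da den at h
  cases hg : (!(Nat.blt c 1732323601) || Nat.beq p9n 0 || Nat.blt P9 p9n) with
  | true => rw [hg] at h; exact absurd h (by simp)
  | false =>
    rw [hg] at h
    simp only [cond_false, Option.some.injEq] at h
    obtain ⟨hc, hp0, hpP⟩ := guard_false hg
    have evv : vv = (3 * ((b0 : ℤ) - a0) + ((rB : ℤ) - rA), 3 * ((b1 : ℤ) - a1) + ((rB : ℤ) - rA), (bm : ℤ) - am) := rfl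
    have h0 : (x0 : ℤ) = (3 * ((b0 : ℤ) - a0) + ((rB : ℤ) - rA)) + 3603 := offset_coord a0 b0 rA rB ha0 hrA
    have h1 : (x1 : ℤ) = (3 * ((b1 : ℤ) - a1) + ((rB : ℤ) - rA)) + 3603 := offset_coord a1 b1 rA rB ha1 hrA
    have hm : (xm : ℤ) = ((bm : ℤ) - am) + 1201 := offset_layer am bm ham
    have e9 : (p9n : ℤ) = n9Z vv := by
      rw [offset_n9 x0 x1 xm _ _ _ h0 h1 hm, evv]; simp only [n9Z]
    have e9n : (n9Z vv).toNat = p9n := by rw [← e9]; simp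
    have eform : ((P : ℤ) - Q) = formZ f0 f1 g vv := by
      have := offset_form f0 f1 g (3603 * (f0 + f1) + 1201 * g) x0 x1 xm
      rw [this, h0, h1, hm, evv]; simp only [formZ]; ring
    have eda : da = (formZ f0 f1 g vv).natAbs := by
      have h' := offset_absdiff P Q
      rw [eform] at h'
      rw [← Int.natCast_natAbs] at h'
      exact_mod_cast h'
    refine ⟨hc, by rw [← e9]; exact_mod_cast hp0, by rw [← e9]; exact_mod_cast hpP, ?_⟩
    rw [← h, e9n, ← eda]
    rfl


/-! ## §4 all trials of one piece, and the walk invariant -/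

/-- the window key of a kernel piece. -/
def keyOf (pr : (ℕ × ℕ × ℕ) × (ℕ × ℕ × ℕ)) : ℕ := keyO pr.1.1 pr.1.2.1 pr.1.2.2 pr.2.1 pr.2.2.1 pr.2.2.2

/-- the context an admissible `ρ` selects: far trial letter `ρ amY` and the sign-split form of `(f0, f1, g)`. -/
def ctxOf (ρ : ℕ → ℕ) (amY : ℕ) (f0 f1 g : ℤ) (Bn U4n cR : ℕ) : OCtx :=
  ⟨ρ amY, f0.toNat, (-f0).toNat, f1.toNat, (-f1).toNat, g.toNat, (-g).toNat,
    (3603 * (f0 + f1) + 1201 * g).toNat, (-(3603 * (f0 + f1) + 1201 * g)).toNat, Bn, U4n, cR⟩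

/-- ★ ALL TRIALS OF ONE PIECE ARE SOUND for every admissible `ρ` whose context is among `ctxs`: a successful `pieceO` certifies the code
range, `0 < n9 ≤ P9max` for the piece vector UNDER `ρ`, and dominates `ρ`'s N coefficient. [folklore] -/
theorem pieceO_sound {win : List ℕ} {wlo whi amY P9 An : ℕ} {ctxs : List OCtx} {ρ : ℕ → ℕ} (hρ : AdmO win wlo whi ρ)
    {f0 f1 g : ℤ} {Bn U4n cR : ℕ} (hκ : ctxOf ρ amY f0 f1 g Bn U4n cR ∈ ctxs) {a0 a1 am c cN : ℕ}
    (ha0 : a0 < 1201) (ha1 : a1 < 1201) (ham : am < 1201) (h : pieceO win wlo whi amY P9 An ctxs a0 a1 am c = some cN) :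
    c < 1732323601 ∧ 0 < n9Z (vecL ρ ((a0, a1, am), dec3 c)) ∧ n9Z (vecL ρ ((a0, a1, am), dec3 c)) ≤ P9 ∧
      coefNn An Bn U4n (n9Z (vecL ρ ((a0, a1, am), dec3 c))).toNat (formZ f0 f1 g (vecL ρ ((a0, a1, am), dec3 c))).natAbs ≤ cN := by
  unfold pieceO at h
  extract_lets b0 b1 bm freeA freeB at h
  set ra := trialA wlo whi amY am ρ with hra
  set rb := trialB wlo whi amY am bm ρ with hrb
  have hmem : pieceEvalO win wlo whi amY P9 An (ctxOf ρ amY f0 f1 g Bn U4n cR) a0 a1 am b0 b1 bm c ra rb ∈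
      ctxs.flatMap (fun κ => (trials freeA).flatMap fun ra => (trials freeB).map fun rb =>
        pieceEvalO win wlo whi amY P9 An κ a0 a1 am b0 b1 bm c ra rb) := by
    refine List.mem_flatMap.mpr ⟨_, hκ, List.mem_flatMap.mpr ⟨ra, ?_, List.mem_map.mpr ⟨rb, ?_, rfl⟩⟩⟩
    · exact trialA_mem wlo whi amY am hρ.2
    · exact trialB_mem wlo whi amY am bm hρ.2
  obtain ⟨v, hv, hvle⟩ := maxAll_some _ _ h _ hmem
  have hA : regO win wlo whi amY (ρ amY) am ra rb am = ρ am := regO_trial_start hρ amY am bm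
  have hB : regO win wlo whi amY (ρ amY) am ra rb bm = ρ bm := regO_trial_end hρ amY am bm
  have hrA : regO win wlo whi amY (ρ amY) am ra rb am ≤ 2 := by rw [hA]; exact hρ.2 am
  obtain ⟨hc, h0, hP, hveq⟩ := pieceEvalO_sound win wlo whi amY P9 An (ρ amY) Bn U4n cR f0 f1 g ha0 ha1 ham hrA hv
  have hvv : ((3 * ((b0 : ℤ) - a0) + ((regO win wlo whi amY (ρ amY) am ra rb bm : ℤ) - regO win wlo whi amY (ρ amY) am ra rb am),
      3 * ((b1 : ℤ) - a1) + ((regO win wlo whi amY (ρ amY) am ra rb bm : ℤ) - regO win wlo whi amY (ρ amY) am ra rb am), (bm : ℤ) - am)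
        : ℤ × ℤ × ℤ) = vecL ρ ((a0, a1, am), dec3 c) := by
    rw [hA, hB]; rfl
  rw [hvv] at h0 hP hveq
  exact ⟨hc, h0, hP, hveq ▸ hvle⟩

/-- unfolding the out walk on no code. [folklore] -/
theorem walkPO_nil (win : List ℕ) (wlo whi amY P9 An : ℕ) (ctxs : List OCtx) (a0 a1 am : ℕ) (t : PT) :
    walkPO win wlo whi amY P9 An ctxs a0 a1 am [] t = some t := rfl

/-- unfolding the out walk on a code. [folklore] -/
theorem walkPO_cons (win : List ℕ) (wlo whi amY P9 An : ℕ) (ctxs : List OCtx) (a0 a1 am c : ℕ) (rest : List ℕ) (t : PT) :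
    walkPO win wlo whi amY P9 An ctxs a0 a1 am (c :: rest) t =
      (match pieceO win wlo whi amY P9 An ctxs a0 a1 am c with
      | none => none
      | some cN =>
        match t.bump (keyO a0 a1 am (c / 1442401) (c / 1201 % 1201) (c % 1201)) (cRmax ctxs) cN with
        | none => none
        | some t' => walkPO win wlo whi amY P9 An ctxs (c / 1442401) (c / 1201 % 1201) (c % 1201) rest t') := rfl

/-- ★★ THE OUT WALK INVARIANT.  For every admissible `ρ` whose context is listed, a successful out walk from an in-range site certifies
every piece UNDER `ρ` (`0 < n9 ≤ P9max`, targets in range), grows the key-wise R sums by exactly `cRmax` per piece, and grows the key-wise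
N sums by AT LEAST `ρ`'s N coefficient per piece. [folklore] -/
theorem walkPO_sound (win : List ℕ) (wlo whi amY P9 An : ℕ) (ctxs : List OCtx) {ρ : ℕ → ℕ} (hρ : AdmO win wlo whi ρ)
    {f0 f1 g : ℤ} {Bn U4n cR : ℕ} (hκ : ctxOf ρ amY f0 f1 g Bn U4n cR ∈ ctxs) :
    ∀ (cs : List ℕ) (a0 a1 am : ℕ) (t t' : PT), a0 < 1201 → a1 < 1201 → am < 1201 →
    walkPO win wlo whi amY P9 An ctxs a0 a1 am cs t = some t' →
    (∀ pr ∈ piecesFrom (a0, a1, am) cs,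
        pr.2.1 < 1201 ∧ pr.2.2.1 < 1201 ∧ pr.2.2.2 < 1201 ∧ 0 < n9Z (vecL ρ pr) ∧ n9Z (vecL ρ pr) ≤ P9) ∧
    (∀ q, tabR t'.toList q = tabR t.toList q + (((piecesFrom (a0, a1, am) cs).filter fun pr => keyOf pr = q).map fun _ => cRmax ctxs).sum) ∧
    (∀ q, tabN t.toList q + (((piecesFrom (a0, a1, am) cs).filter fun pr => keyOf pr = q).map fun pr =>
        coefNn An Bn U4n (n9Z (vecL ρ pr)).toNat (formZ f0 f1 g (vecL ρ pr)).natAbs).sum ≤ tabN t'.toList q)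
  | [], a0, a1, am, t, t', _, _, _, h => by
    rw [walkPO_nil, Option.some.injEq] at h
    subst h
    simp [piecesFrom_nil]
  | c :: rest, a0, a1, am, t, t', ha0, ha1, ham, h => by
    rw [walkPO_cons] at h
    cases hpc : pieceO win wlo whi amY P9 An ctxs a0 a1 am c with
    | none => rw [hpc] at h; exact absurd h (by simp)
    | some cN =>
      rw [hpc] at h
      simp only at h
      cases hb : t.bump (keyO a0 a1 am (c / 1442401) (c / 1201 % 1201) (c % 1201)) (cRmax ctxs) cN with
      | none => rw [hb] at h; exact absurd h (by simp)
      | some t₁ =>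
        rw [hb] at h
        simp only at h
        obtain ⟨hc, hp0, hpP, hcoef⟩ := pieceO_sound hρ hκ ha0 ha1 ham hpc
        obtain ⟨hb0, hb1, hbm⟩ := dec3_lt hc
        obtain ⟨IH1, IH2, IH3⟩ := walkPO_sound win wlo whi amY P9 An ctxs hρ hκ rest _ _ _ t₁ t' hb0 hb1 hbm h
        have hdec : dec3 c = (c / 1442401, c / 1201 % 1201, c % 1201) := rfl
        rw [hdec] at hp0 hpP hcoef
        have ekey : keyOf ((a0, a1, am), (c / 1442401, c / 1201 % 1201, c % 1201)) =
            keyO a0 a1 am (c / 1442401) (c / 1201 % 1201) (c % 1201) := rfl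
        refine ⟨?_, ?_, ?_⟩
        · intro pr hpr
          rw [piecesFrom_cons, hdec, List.mem_cons] at hpr
          rcases hpr with rfl | hpr
          · exact ⟨hb0, hb1, hbm, hp0, hpP⟩
          · exact IH1 pr hpr
        · intro q
          rw [IH2 q, tabR_bump hb q, piecesFrom_cons, hdec, List.filter_cons]
          by_cases hq : keyOf ((a0, a1, am), (c / 1442401, c / 1201 % 1201, c % 1201)) = q
          · have hq' := hq
            rw [ekey] at hq'
            simp [hq, hq']; ring
          · have hq' : ¬ (keyO a0 a1 am (c / 1442401) (c / 1201 % 1201) (c % 1201) = q) := by rwa [ekey] at hq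
            simp [hq, hq']
        · intro q
          have step := tabN_bump hb q
          have ih := IH3 q
          rw [piecesFrom_cons, hdec, List.filter_cons]
          by_cases hq : keyOf ((a0, a1, am), (c / 1442401, c / 1201 % 1201, c % 1201)) = q
          · have hq' := hq
            rw [ekey] at hq'
            simp only [hq, decide_true, if_true, List.map_cons, List.sum_cons]
            rw [hq', if_pos rfl] at step
            linarith
          · have hq' : ¬ (keyO a0 a1 am (c / 1442401) (c / 1201 % 1201) (c % 1201) = q) := by rwa [ekey] at hq
            simp only [hq, decide_false, Bool.false_eq_true, if_false]
            rw [if_neg hq'] at step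
            linarith

end Summit.AtomisticToContinuum.Crystallization.Theorems.ChartedZeroExcessLayeredLatticeLiouville.ThetaKernel
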